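import Summits.ResolutionOfSingularities.ResolutionOfSingularities.Theses.Valuative
import Summits.ResolutionOfSingularities.ResolutionOfSingularities.Theorems.ValuativeLuAlphaPTorsorPthPowerModMonomial
import Literature.FieldTheory.Separability.PIndependentDerivations
import Literature.AlgebraicGeometry.Resolution.RegularLocalRingsNormal
import Literature.AlgebraicGeometry.Resolution.RegularSystemOfParameters

/-!
# Log-principalization in base dimension `≤ 1` (crux `Valuative.LuAlphaPTorsor`, line `pfaff-line-log-final-forms`)

Helper file for the LEAD's stub `stub_logPrincipalization` of the skeleton
`Cruxes/LuAlphaPTorsor/Lines/pfaff-line-log-final-forms.lean` (item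
`stmt-ResolutionOfSingularities-0641`). That stub — principalize the log-content ideal of
`a = t^p` on a regular local blow-up of the base along the valuation — is the hard core of the
line (monomialization of `a` modulo `p`-th powers along `ν`; open in base dimension `≥ 4`).
This file proves the two cases in which NO blow-up is needed:

* `exists_derivation_apply_ne_zero` — **non-`p`-th powers are detected by `ℤ`-derivations**:
  for a regular local ring `R` presented as a quotient of a localized polynomial ring over a
  field of characteristic `p`, if `a ∈ R` is not a `p`-th power then `δ a ≠ 0` for some
  `δ ∈ Der_ℤ(R)` (normality of `R` keeps `a` a non-`p`-th power in `L = Frac R`; a derivation of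
  `L` vanishing on `L^p` with `D a = 1` exists by Matsumura §26; the richness theorem
  `exists_derivations_sum_eq` of `…PthPowerModMonomialRichness.lean` expands `D|_R` in
  `ℤ`-derivations of `R`).
* `logPrincipalization_of_ringKrullDim_le_one` — the stub's conclusion with `A₁ = A₀` when the
  local ring of the base at the centre has dimension `≤ 1`: in dimension `0` the content ideal is
  the unit ideal; in dimension `1` the base is a discrete valuation ring and every non-zero
  ideal is a power `(ϖ^n)` of the maximal ideal (the content is non-zero: `ϖ • δ` is logarithmic
  and `ϖ · δ a ≠ 0`).
* `logPrincipalization_of_isUnit_derivation` — the stub's conclusion with `A₁ = A₀` and empty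
  boundary when some `ℤ`-derivation of the base takes `t^p` to a unit.
-/

set_option linter.dupNamespace false

namespace Summit.ResolutionOfSingularities.ResolutionOfSingularities.Theorems.PfaffLine

open IsLocalRing Literature.AlgebraicGeometry.Resolution Literature.FieldTheory.Separability

/-! ## Non-`p`-th powers are detected by `ℤ`-derivations -/

/-- In an integrally closed domain `R` with fraction field `L`, an element which is not a `p`-th
power in `R` is not a `p`-th power in `L`. [folklore] -/
theorem not_exists_pow_eq_algebraMap_of_forall_ne_pow {R : Type*} [CommRing R] [IsDomain R]
    [IsIntegrallyClosed R] {L : Type*} [Field L] [Algebra R L] [IsFractionRing R L]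
    {p : ℕ} (hp : p ≠ 0) {a : R} (ha : ∀ c : R, a ≠ c ^ p) :
    ∀ z : L, z ^ p ≠ algebraMap R L a := by
  intro z hz
  have hint : IsIntegral R z := by
    refine ⟨Polynomial.X ^ p - Polynomial.C a, Polynomial.monic_X_pow_sub_C a hp, ?_⟩
    simp [Polynomial.eval₂_sub, Polynomial.eval₂_X_pow, Polynomial.eval₂_C, hz]
  obtain ⟨c, hc⟩ := IsIntegrallyClosed.algebraMap_eq_of_integral hint
  apply ha c
  apply IsFractionRing.injective R L
  rw [map_pow, hc, hz]

/-- **Non-`p`-th powers are detected by `ℤ`-derivations.** Let `Φq : k[X]_𝔮 ↠ R` present the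
regular local ring `R`, `char k = p`. If `a ∈ R` is not a `p`-th power in `R`, then `δ a ≠ 0`
for some `ℤ`-derivation `δ` of `R`. [folklore] -/
theorem exists_derivation_apply_ne_zero {k : Type} [Field k] {p : ℕ} (hp : p.Prime) [CharP k p]
    {n : ℕ} {R : Type} [CommRing R] [Algebra ℤ R] [IsRegularLocalRing R]
    (𝔮 : Ideal (MvPolynomial (Fin n) k)) [𝔮.IsPrime] (Φq : Localization.AtPrime 𝔮 →+* R)
    (hsurj : Function.Surjective Φq) {a : R} (ha : ∀ c : R, a ≠ c ^ p) :
    ∃ δ : Derivation ℤ R R, δ a ≠ 0 := by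
  classical
  haveI : Fact p.Prime := ⟨hp⟩
  haveI := isDomain_of_isRegularLocalRing R
  haveI := isIntegrallyClosed_of_isRegularLocalRing R
  let L := FractionRing R
  -- `L` has characteristic `p` (the composite `k → k[X] → k[X]_𝔮 → R → L` is a map of rings)
  haveI : CharP L p := by
    have f : k →+* L := ((algebraMap R L).comp Φq).comp
      (algebraMap k (Localization.AtPrime 𝔮))
    exact charP_of_injective_ringHom f.injective p
  -- `a` is not a `p`-th power in `L`
  set b : L := algebraMap R L a with hb
  have hbF : b ∉ pAdjoin p (∅ : Set L) := by
    intro hmem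
    have hcl : pAdjoin p (∅ : Set L) = (frobenius L p).fieldRange := by
      rw [pAdjoin, Set.union_empty]
      refine le_antisymm (Subfield.closure_le.mpr ?_) fun x hx => Subfield.subset_closure ?_
      · rintro x ⟨y, rfl⟩
        exact ⟨y, rfl⟩
      · obtain ⟨y, rfl⟩ := (RingHom.mem_fieldRange).mp hx
        exact ⟨y, rfl⟩
    rw [hcl] at hmem
    obtain ⟨z, hz⟩ := (RingHom.mem_fieldRange).mp hmem
    exact not_exists_pow_eq_algebraMap_of_forall_ne_pow hp.ne_zero ha z (by
      rw [← frobenius_def, hz, hb])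
  obtain ⟨D, hD1, -⟩ := exists_derivation_eq_one_eqOn_zero p (pAdjoin p (∅ : Set L))
    (pow_mem_pAdjoin _) hbF
  -- restrict `D` to `R` and expand it in `ℤ`-derivations of `R`
  set ψ : R →+* L := algebraMap R L with hψ
  let δ₀ : R →+ L :=
    { toFun := fun x => D (algebraMap R L x)
      map_zero' := by simp only [map_zero]
      map_add' := fun x y => by simp only [map_add] }
  have hδ₀apply : ∀ x, δ₀ x = D (algebraMap R L x) := fun _ => rfl
  -- Leibniz for `D`, read off the term (the `ℤ`-algebra instance on `L` is not canonical)
  have hDl : ∀ x y : L, D (x * y) = x • D y + y • D x :=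
    @Derivation.leibniz ℤ L L _ _ _ (_) _ (_) D
  have hleib : ∀ x y, δ₀ (x * y) = ψ x * δ₀ y + ψ y * δ₀ x := by
    intro x y
    rw [hδ₀apply, hδ₀apply, hδ₀apply, map_mul, hDl, smul_eq_mul, smul_eq_mul]
  obtain ⟨m, Δ, nn, hsum⟩ :=
    exists_derivations_sum_eq k n 𝔮 Φq hsurj p L ψ δ₀ hleib {a}
  have hsa := hsum a (Finset.mem_singleton_self a)
  by_contra hcon
  push Not at hcon
  have hzero : ∀ j, ψ (Δ j a) * nn j = 0 := fun j => by rw [hcon (Δ j), map_zero, zero_mul]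
  rw [Finset.sum_eq_zero (fun j _ => hzero j), hδ₀apply, ← hb, hD1] at hsa
  exact one_ne_zero hsa

/-! ## The abstract principalization statements in dimension `≤ 1` -/

/-- **Dimension `≤ 1`: the log-content of a non-`p`-th power is a power of the maximal ideal.**
For `R` regular local of dimension `d ≤ 1` presented as `Φq : k[X]_𝔮 ↠ R`, `char k = p`, a
regular system of parameters `u : Fin d → R`, and `a ∈ R` not a `p`-th power, there are
exponents `M` with `Ideal.span {δ a | δ ∈ Der_ℤ(R) logarithmic along all uᵢ} = (∏ᵢ uᵢ ^ Mᵢ)`.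
[folklore] -/
theorem exists_content_eq_span_prod_pow_of_ringKrullDim_le_one {k : Type} [Field k] {p : ℕ}
    (hp : p.Prime) [CharP k p] {n : ℕ} {R : Type} [CommRing R] [Algebra ℤ R]
    [IsRegularLocalRing R] (𝔮 : Ideal (MvPolynomial (Fin n) k)) [𝔮.IsPrime]
    (Φq : Localization.AtPrime 𝔮 →+* R) (hsurj : Function.Surjective Φq)
    (hdim : ringKrullDim R ≤ 1) {d : ℕ} (u : Fin d → R)
    (hu : Ideal.span (Set.range u) = maximalIdeal R) (hdimd : ringKrullDim R = (d : WithBot ℕ∞))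
    {a : R} (ha : ∀ c : R, a ≠ c ^ p) :
    ∃ M : Fin d → ℕ,
      Ideal.span {b | ∃ δ : Derivation ℤ R R,
          (∀ i ∈ (Finset.univ : Finset (Fin d)), δ (u i) ∈ Ideal.span {u i}) ∧ δ a = b} =
        Ideal.span {(Finset.univ : Finset (Fin d)).prod fun i => u i ^ M i} := by
  classical
  haveI := isDomain_of_isRegularLocalRing R
  obtain ⟨δ, hδ⟩ := exists_derivation_apply_ne_zero hp 𝔮 Φq hsurj ha
  have hdle : d ≤ 1 := by
    have h1 : ((d : ℕ∞) : WithBot ℕ∞) ≤ ((1 : ℕ∞) : WithBot ℕ∞) := by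
      have := hdim
      rw [hdimd] at this
      exact_mod_cast this
    exact_mod_cast (WithBot.coe_le_coe.mp h1)
  rcases Nat.le_one_iff_eq_zero_or_eq_one.mp hdle with hd0 | hd1
  · -- dimension `0`: `R` is a field, the content contains the non-zero element `δ a`
    subst hd0
    have hbot : maximalIdeal R = ⊥ := by
      rw [← hu, Ideal.span_eq_bot]
      rintro x ⟨i, rfl⟩
      exact i.elim0
    have hfield : IsField R := (IsLocalRing.isField_iff_maximalIdeal_eq).mpr hbot
    refine ⟨fun _ => 0, ?_⟩
    have hE : (Finset.univ : Finset (Fin 0)).prod (fun i => u i ^ (fun _ => 0) i) = 1 :=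
      Finset.prod_eq_one fun i _ => by simp
    rw [hE, Ideal.span_singleton_one]
    have hunit : IsUnit (δ a) := by
      letI := hfield.toField
      exact isUnit_iff_ne_zero.mpr hδ
    exact Ideal.eq_top_of_isUnit_mem _ (Ideal.subset_span ⟨δ, fun i _ => i.elim0, rfl⟩) hunit
  · -- dimension `1`: `R` is a DVR with uniformizer `ϖ = u 0`
    subst hd1
    have hfin1 : ∀ i : Fin 1, i = 0 := fun i => Fin.ext (by have := i.2; omega)
    have hrange : Set.range u = {u 0} := by
      ext x
      constructor
      · rintro ⟨i, rfl⟩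
        rw [hfin1 i]
        rfl
      · rintro rfl
        exact ⟨0, rfl⟩
    have hmax : maximalIdeal R = Ideal.span {u 0} := by rw [← hu, hrange]
    have hne : maximalIdeal R ≠ ⊥ := by
      intro hbot
      have hfield : IsField R := (IsLocalRing.isField_iff_maximalIdeal_eq).mpr hbot
      have h0 : ringKrullDim R = 0 := by
        letI := hfield.toField
        exact ringKrullDim_eq_zero_of_field R
      rw [hdimd] at h0
      simp at h0
    have hϖ0 : u 0 ≠ 0 := by
      intro h
      apply hne
      rw [hmax, h]
      simp
    -- every non-zero ideal is a power of `𝔪`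
    have hprinc : (maximalIdeal R).IsPrincipal := ⟨⟨u 0, by rw [hmax]⟩⟩
    have htfae := tfae_of_isNoetherianRing_of_isLocalRing_of_isDomain R
    have hpow : ∀ I : Ideal R, I ≠ ⊥ → ∃ m : ℕ, I = maximalIdeal R ^ m :=
      (htfae.out 4 6).mp hprinc
    -- the content ideal is non-zero: `ϖ • δ` is logarithmic and `ϖ · δ a ≠ 0`
    have hCne : Ideal.span {b | ∃ δ' : Derivation ℤ R R,
        (∀ i ∈ (Finset.univ : Finset (Fin 1)), δ' (u i) ∈ Ideal.span {u i}) ∧ δ' a = b} ≠ ⊥ := by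
      intro hC0
      have hmem : (u 0 • δ) a ∈ Ideal.span {b | ∃ δ' : Derivation ℤ R R,
          (∀ i ∈ (Finset.univ : Finset (Fin 1)), δ' (u i) ∈ Ideal.span {u i}) ∧ δ' a = b} := by
        refine Ideal.subset_span ⟨u 0 • δ, fun i _ => ?_, rfl⟩
        rw [Derivation.smul_apply, smul_eq_mul, hfin1 i]
        exact Ideal.mul_mem_right _ _ (Ideal.mem_span_singleton_self _)
      rw [hC0, Ideal.mem_bot, Derivation.smul_apply, smul_eq_mul] at hmem
      exact (mul_ne_zero hϖ0 hδ) hmem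
    obtain ⟨m, hm⟩ := hpow _ hCne
    refine ⟨fun _ => m, ?_⟩
    rw [hm, hmax, Ideal.span_singleton_pow, Fin.prod_univ_one]

/-- **A unit derivative: empty boundary.** If some `ℤ`-derivation of the regular local ring `R`
takes `a` to a unit, then for any regular system of parameters `u` the log-content of `a` with
EMPTY boundary is the unit ideal `(∏_{i∈∅} uᵢ ^ Mᵢ) = R`. [folklore] -/
theorem content_eq_top_of_isUnit_derivation {R : Type*} [CommRing R] [Algebra ℤ R] [IsLocalRing R]
    {d : ℕ} (u : Fin d → R) (M : Fin d → ℕ) {a : R} (δ : Derivation ℤ R R) (hδ : IsUnit (δ a)) :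
    Ideal.span {b | ∃ δ' : Derivation ℤ R R,
        (∀ i ∈ (∅ : Finset (Fin d)), δ' (u i) ∈ Ideal.span {u i}) ∧ δ' a = b} =
      Ideal.span {(∅ : Finset (Fin d)).prod fun i => u i ^ M i} := by
  rw [Finset.prod_empty, Ideal.span_singleton_one]
  refine Ideal.eq_top_of_isUnit_mem _ (Ideal.subset_span ⟨δ, fun i hi => ?_, rfl⟩) hδ
  exact absurd hi (Finset.notMem_empty i)

/-! ## The stub's conclusion in the two blow-up-free cases -/

/-- **`stub_logPrincipalization` in base dimension `≤ 1`, with `A₁ = A₀`.** In the setting of the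
crux `Valuative.LuAlphaPTorsor` (`A₀ ⊆ O` finitely generated, regular at the centre, `t^p ∈ A₀`
not a `p`-th power in the local ring `R₀` of the base at the centre): if `dim R₀ ≤ 1` then the
log-content ideal of `t^p` in `R₀` is already a monomial ideal `(∏ uᵢ^{Mᵢ})` for a regular
system of parameters `u` of `R₀` (full boundary). The hypothesis `IsFractionRing … K` of the stub
is not needed here. [folklore] -/
theorem logPrincipalization_of_ringKrullDim_le_one :
    ∀ p : ℕ, p.Prime → ∀ (k K : Type) [Field k] [CharP k p] [Field K] [Algebra k K] (O : ValuationSubring K) (A₀ : Subalgebra k K) (h₀ : A₀.toSubring ≤ O.toSubring) (t : K), A₀.FG → ∀ (htp : t ^ p ∈ A₀), IsRegularLocalRing (Localization.AtPrime (Ideal.comap (Subring.inclusion h₀) (IsLocalRing.maximalIdeal O))) → ringKrullDim (Localization.AtPrime (Ideal.comap (Subring.inclusion h₀) (IsLocalRing.maximalIdeal O))) ≤ 1 → (∀ c : Localization.AtPrime (Ideal.comap (Subring.inclusion h₀) (IsLocalRing.maximalIdeal O)), algebraMap A₀.toSubring (Localization.AtPrime (Ideal.comap (Subring.inclusion h₀)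 (IsLocalRing.maximalIdeal O))) ⟨t ^ p, htp⟩ ≠ c ^ p) → ∃ (A₁ : Subalgebra k K) (h₁ : A₁.toSubring ≤ O.toSubring) (hle : A₀ ≤ A₁), A₁.FG ∧ IsRegularLocalRing (Localization.AtPrime (Ideal.comap (Subring.inclusion h₁) (IsLocalRing.maximalIdeal O))) ∧ ∃ (d : ℕ) (u : Fin d → Localization.AtPrime (Ideal.comap (Subring.inclusion h₁) (IsLocalRing.maximalIdeal O))) (E : Finset (Fin d)) (M : Fin d → ℕ), Ideal.span (Set.range u) = IsLocalRing.maximalIdeal (Localization.AtPrime (Ideal.comap (Subring.inclusion h₁) (IsLocalRing.maximalIdeal O))) ∧ ringKrullDim (Localization.AtPrime (Ideal.comap (Subring.inclusion h₁) (IsLocalRing.maximalIdeal O))) = (d : WithBot ℕ∞) ∧ Ideal.span {b | ∃ δ : Derivation ℤ (Localization.AtPrime (Ideal.comap (Subring.inclusion h₁) (IsLocalRing.maximalIdeal O))) (Localization.AtPrime (Ideal.comap (Subring.inclusion h₁) (IsLocalRing.maximalIdeal O))), (∀ i ∈ E, δ (u i) ∈ Ideal.span {u i}) ∧ δ (algebraMap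 A₁.toSubring (Localization.AtPrime (Ideal.comap (Subring.inclusion h₁) (IsLocalRing.maximalIdeal O))) ⟨t ^ p, hle htp⟩) = b} = Ideal.span {E.prod fun i => u i ^ M i} := by
  intro p hp k K _ _ _ _ O A₀ h₀ t hfg htp hreg hdim hpow
  -- presentation `k[X]_𝔮 ↠ (A₀)_𝔭`
  obtain ⟨n, Φ, hΦ⟩ := exists_presentation O A₀ h₀ hfg
  obtain ⟨Φq, hsurj, -⟩ := exists_surjective_lift Φ hΦ
  haveI := hreg
  obtain ⟨u, hu⟩ := exists_regularSystemOfParameters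
    (R := Localization.AtPrime (Ideal.comap (Subring.inclusion h₀) (IsLocalRing.maximalIdeal O)))
  have hdimd := (IsRegularLocalRing.spanFinrank_maximalIdeal
    (R := Localization.AtPrime (Ideal.comap (Subring.inclusion h₀) (IsLocalRing.maximalIdeal O)))).symm
  obtain ⟨M, hcontent⟩ :=
    exists_content_eq_span_prod_pow_of_ringKrullDim_le_one hp _ Φq hsurj hdim u hu hdimd hpow
  exact ⟨A₀, h₀, le_rfl, hfg, hreg, _, u, Finset.univ, M, hu, hdimd, hcontent⟩

/-- **`stub_logPrincipalization` when a derivative of `t^p` is a unit, with `A₁ = A₀` and empty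
boundary.** If some `ℤ`-derivation of the local ring `R₀` of the base at the centre takes `t^p`
to a unit (equivalently: `A₀[t]` is regular at the centre by the monogenic criterion), the
log-content of `t^p` with empty boundary is the unit ideal. [folklore] -/
theorem logPrincipalization_of_isUnit_derivation :
    ∀ p : ℕ, p.Prime → ∀ (k K : Type) [Field k] [CharP k p] [Field K] [Algebra k K] (O : ValuationSubring K) (A₀ : Subalgebra k K) (h₀ : A₀.toSubring ≤ O.toSubring) (t : K), A₀.FG → ∀ (htp : t ^ p ∈ A₀), IsRegularLocalRing (Localization.AtPrime (Ideal.comap (Subring.inclusion h₀) (IsLocalRing.maximalIdeal O))) → (∃ δ : Derivation ℤ (Localization.AtPrime (Ideal.comap (Subring.inclusion h₀) (IsLocalRing.maximalIdeal O))) (Localization.AtPrime (Ideal.comap (Subring.inclusion h₀) (IsLocalRing.maximalIdeal O))), IsUnit (δ (algebraMap A₀.toSubring (Localization.AtPrime (Ideal.comap (Subring.inclusion h₀) (IsLocalRing.maximalIdeal O))) ⟨t ^ p, htp⟩))) → ∃ (A₁ : Subalgebra k K) (h₁ : A₁.toSubring ≤ O.toSubring) (hle : A₀ ≤ A₁), A₁.FG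 ∧ IsRegularLocalRing (Localization.AtPrime (Ideal.comap (Subring.inclusion h₁) (IsLocalRing.maximalIdeal O))) ∧ ∃ (d : ℕ) (u : Fin d → Localization.AtPrime (Ideal.comap (Subring.inclusion h₁) (IsLocalRing.maximalIdeal O))) (E : Finset (Fin d)) (M : Fin d → ℕ), Ideal.span (Set.range u) = IsLocalRing.maximalIdeal (Localization.AtPrime (Ideal.comap (Subring.inclusion h₁) (IsLocalRing.maximalIdeal O))) ∧ ringKrullDim (Localization.AtPrime (Ideal.comap (Subring.inclusion h₁) (IsLocalRing.maximalIdeal O))) = (d : WithBot ℕ∞) ∧ Ideal.span {b | ∃ δ : Derivation ℤ (Localization.AtPrime (Ideal.comap (Subring.inclusion h₁) (IsLocalRing.maximalIdeal O))) (Localization.AtPrime (Ideal.comap (Subring.inclusion h₁) (IsLocalRing.maximalIdeal O))), (∀ i ∈ E, δ (u i) ∈ Ideal.span {u i}) ∧ δ (algebraMap A₁.toSubring (Localization.AtPrime (Ideal.comap (Subring.inclusion h₁) (IsLocalRing.maximalIdeal O))) ⟨t ^ p, hle htp⟩) = b} = Ideal.span {E.prod fun i => u i ^ M i} := by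
  intro p hp k K _ _ _ _ O A₀ h₀ t hfg htp hreg hδ
  obtain ⟨δ, hδu⟩ := hδ
  haveI := hreg
  obtain ⟨u, hu⟩ := exists_regularSystemOfParameters
    (R := Localization.AtPrime (Ideal.comap (Subring.inclusion h₀) (IsLocalRing.maximalIdeal O)))
  refine ⟨A₀, h₀, le_rfl, hfg, hreg, _, u, ∅, fun _ => 0, hu,
    (IsRegularLocalRing.spanFinrank_maximalIdeal (R := _)).symm, ?_⟩
  exact content_eq_top_of_isUnit_derivation u (fun _ => 0) δ hδu

end Summit.ResolutionOfSingularities.ResolutionOfSingularities.Theorems.PfaffLine
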